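import Literature.Algebra.Homology.CechLocalization
import HarnessLib

/-!
# Degree zero of the Čech complex of a localizing system: `M → Č⁰ → Č¹` is exact
# (The Stacks Project, Tag 00EK; Görtz–Wedhorn II, Lemma 22.1; Hartshorne II, Prop. 5.1)

[topic Algebra/Homology]

`Literature/Algebra/Homology/CechLocalization` proves that the (full ordered) Čech complex
`∏_{k : [0]→A} L₀(k) → ∏_{k : [1]→A} L₁(k) → ⋯` of a **localizing system** of modules — `L n k` the
localization of `M` away from `t · g_{k 0} ⋯ g_{k n}` through `ι n k : M → L n k`, with the forced
restriction maps — is exact in POSITIVE degrees when the `g_a` generate the unit ideal (The Stacks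
Project, Tag 01X9). This file supplies the complementary statement in degree `0` for twist
`t = 1`, i.e. the sheaf property of `M~` on the standard covering `(D(g_a))_a` of `Spec R`
(The Stacks Project, Tag 00EK = Algebra, Lemma 10.24.1 / 10.24.2: "`0 → M → ⊕ M_{f_i} → ⊕ M_{f_i f_j}`
is exact" when `(f_i) = R`; Görtz–Wedhorn II, Lemma 22.1: "`Ȟ⁰(X, 𝓕) = Γ(X, 𝓕)` and all higher
Čech cohomology groups vanish"; Hartshorne II, Prop. 5.1 (proof of the sheaf property of `M~`)):

* `CechLocalization.eq_zero_of_forall_ι_eq_zero` — **injectivity**: an element of `M` whose image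
  in every `L₀(a) = M_{g_a}` vanishes is zero;
* `CechLocalization.exists_eq_ι_of_cechD_eq_zero` — **gluing**: a `0`-cochain `s` with
  `D s = 0` (i.e. `s_a|_{ab} = s_b|_{ab}` in `M_{g_a g_b}`) is the image of an element of `M`.

Both are the printed partition-of-unity argument (Stacks 00EK): write `g_a^N s_a = ι(r_a)`, compare
on overlaps to get `(g_a g_b)^E (g_b^N r_a − g_a^N r_b) = 0`, absorb the exponents, and glue with
`Σ_a c_a g_a^{N+E} = 1`. Together with `exists_cechD_eq` this is exactly the hypothesis pair
(`RowAugmentation.Exact`, `ADoubleComplex.RowExact`) of the tree's exact-rows comparison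
`Algebra/Homology/DoubleComplexExactRows` for a Čech–de Rham type double complex whose rows are
Čech complexes of localizing systems (consumer: the algebraic Čech–de Rham complex of a basic-open
cover of an affine scheme, `AlgebraicGeometry/HodgeTheory/AlgebraicCechDeRham`).

## References

* The Stacks Project, Tag 00EK (Algebra, Lemma 10.24.1–10.24.2: the sequence
  `0 → M → ⊕ M_{f_i} → ⊕ M_{f_i f_j}`), Tag 01X8–01X9 (Čech cohomology of quasi-coherent modules
  on standard coverings). [StacksProject]
* U. Görtz, T. Wedhorn, *Algebraic Geometry II: Cohomology of Schemes*, Springer Spektrum (2023),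
  doi:10.1007/978-3-658-43031-3, Lemma 22.1, p. 327. [GortzWedhorn2023]
* R. Hartshorne, *Algebraic Geometry*, GTM 52 (1977), II Prop. 5.1 (pp. 110–111: `M~` is a sheaf
  with `Γ(D(f), M~) = M_f`). [Hartshorne1977]

## Design notes

* Everything is proved; no named facts (D-0026). Twist `t = 1` only (for a general twist the
  degree-`0` term is `M_t`, which the localizing-system format does not carry).
* Elements are compared inside `M` (exponent form of `IsLocalizedModule.surj` /
  `IsLocalizedModule.exists_of_eq`), so no localized modules are constructed; the only dependent
  rewriting is along `faceIdx (pair a b) i = single _` through `transfer_apply_congr`.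
-/

namespace Literature.Algebra.Homology

namespace CechLocalization

universe u uA uM v

open scoped BigOperators

variable {R : Type u} [CommRing R] {A : Type uA} {g : A → R}
  {M : Type uM} [AddCommGroup M] [Module R M]
  {L : ∀ n : ℕ, (Fin (n + 1) → A) → Type v} [∀ n k, AddCommGroup (L n k)] [∀ n k, Module R (L n k)]
  {ι : ∀ (n : ℕ) (k : Fin (n + 1) → A), M →ₗ[R] L n k}

/-! ### One- and two-entry index tuples -/

/-- The one-entry tuple `(a)`, indexing the open `D(g_a)`. [folklore] -/
def single (a : A) : Fin 1 → A := fun _ => a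

/-- Every `[0] → A` is a one-entry tuple. [cite: StacksProject, Tag 00EK] -/
theorem eq_single (k : Fin 1 → A) : k = single (k 0) :=
  funext fun j => by rw [Subsingleton.elim j 0]; rfl

/-- `gprod (a) = g_a`. [cite: StacksProject, Tag 00EK] -/
theorem gprod_single (a : A) : gprod g (single a) = g a := by
  simp [gprod, single]

/-- The two-entry tuple `(a, b)`, indexing the overlap `D(g_a) ∩ D(g_b)`. [folklore] -/
def pair (a b : A) : Fin 2 → A := Fin.cons a (single b)

/-- `gprod (a, b) = g_a g_b`. [cite: StacksProject, Tag 00EK] -/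
theorem gprod_pair (a b : A) : gprod g (pair a b) = g a * g b := by
  simp [gprod, pair, single, Fin.prod_univ_two]

/-- `(a, b) ∘ δ₀ = (b)`. [cite: StacksProject, Tag 00EK] -/
theorem faceIdx_pair_zero (a b : A) : faceIdx (pair a b) 0 = single b :=
  faceIdx_cons_zero a (single b)

/-- `(a, b) ∘ δ₁ = (a)`. [cite: StacksProject, Tag 00EK] -/
theorem faceIdx_pair_one (a b : A) : faceIdx (pair a b) 1 = single a := by
  funext j
  rw [Fin.eq_zero j]
  simp [faceIdx, pair, single, SimplexCategory.δ]

/-! ### Exponent form of the localization properties (twist `1`) -/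

/-- **Kernel**: if `ι_k m = 0` then `gprod(k)^e m = 0` for some `e`. [cite: StacksProject, Tag 00EK] -/
theorem exists_pow_smul_eq_zero (hL : IsSystem g 1 L ι) {n : ℕ} (k : Fin (n + 1) → A) {m : M}
    (h : ι n k m = 0) : ∃ e : ℕ, gprod g k ^ e • m = 0 := by
  haveI := hL.isLocalizedModule n k
  obtain ⟨⟨c, hc⟩, hcm⟩ := IsLocalizedModule.exists_of_eq (S := pw g 1 k) (f := ι n k)
    (x₁ := m) (x₂ := 0) (by rw [h, map_zero])
  obtain ⟨e, rfl⟩ := (Submonoid.mem_powers_iff _ _).mp hc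
  refine ⟨e, ?_⟩
  simpa only [Submonoid.smul_def, one_mul, smul_zero] using hcm

/-- **Numerators**: every `y ∈ L_k` satisfies `gprod(k)^e y = ι_k m` for some `e`, `m`.
[cite: StacksProject, Tag 00EK] -/
theorem exists_pow_smul_eq_ι (hL : IsSystem g 1 L ι) {n : ℕ} (k : Fin (n + 1) → A) (y : L n k) :
    ∃ (e : ℕ) (m : M), gprod g k ^ e • y = ι n k m := by
  haveI := hL.isLocalizedModule n k
  obtain ⟨⟨m, ⟨c, hc⟩⟩, h⟩ := IsLocalizedModule.surj (pw g 1 k) (ι n k) y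
  obtain ⟨e, rfl⟩ := (Submonoid.mem_powers_iff _ _).mp hc
  refine ⟨e, m, ?_⟩
  simpa only [Submonoid.smul_def, one_mul] using h

/-- **Units**: the powers of `gprod(k)` act injectively on `L_k`. [cite: StacksProject, Tag 00EK] -/
theorem smul_pow_injective (hL : IsSystem g 1 L ι) {n : ℕ} (k : Fin (n + 1) → A) (e : ℕ)
    {y y' : L n k} (h : gprod g k ^ e • y = gprod g k ^ e • y') : y = y' := by
  haveI := hL.isLocalizedModule n k
  have hu : IsUnit (algebraMap R (Module.End R (L n k)) (gprod g k ^ e)) := by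
    have := IsLocalizedModule.map_units (ι n k) (⟨(1 * gprod g k) ^ e, e, rfl⟩ : pw g 1 k)
    simpa only [one_mul] using this
  refine ((Module.End.isUnit_iff _).mp hu).1 ?_
  simpa only [Module.algebraMap_end_apply] using h

/-- Units for the one-entry sub-tuples of `(a, b)`. [cite: StacksProject, Tag 00EK] -/
theorem isUnit_single_pair_left (hL : IsSystem g 1 L ι) (a b : A) (x : pw g 1 (single a)) :
    IsUnit (algebraMap R (Module.End R (L 1 (pair a b))) x) :=
  isUnit_of_subset hL (k' := single a) (k := pair a b) (fun _ => ⟨0, rfl⟩) x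

/-- Units for the one-entry sub-tuples of `(a, b)`. [cite: StacksProject, Tag 00EK] -/
theorem isUnit_single_pair_right (hL : IsSystem g 1 L ι) (a b : A) (x : pw g 1 (single b)) :
    IsUnit (algebraMap R (Module.End R (L 1 (pair a b))) x) :=
  isUnit_of_subset hL (k' := single b) (k := pair a b) (fun _ => ⟨1, rfl⟩) x

/-- **The cocycle condition in degree `0`, unpacked**: `D s = 0` says that `s_b` and `s_a` have the
same restriction to `L_{(a,b)} = M_{g_a g_b}`. [cite: StacksProject, Tag 00EK] -/
theorem transfer_eq_transfer_of_cechD_eq_zero (hL : IsSystem g 1 L ι) (s : Cochain L 0)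
    (hs : cechD hL 0 s = 0) (a b : A) :
    transfer L ι hL (single b) (pair a b) (isUnit_single_pair_right hL a b) (s (single b)) =
      transfer L ι hL (single a) (pair a b) (isUnit_single_pair_left hL a b) (s (single a)) := by
  have h := congrFun hs (pair a b)
  rw [cechD_apply, Fin.sum_univ_two, Pi.zero_apply, Fin.val_zero, pow_zero, one_smul, Fin.val_one,
    pow_one, neg_smul, one_smul, ← sub_eq_add_neg, sub_eq_zero, face, face,
    transfer_apply_congr hL s (faceIdx_pair_zero a b) (pair a b) _ (isUnit_single_pair_right hL a b),
    transfer_apply_congr hL s (faceIdx_pair_one a b) (pair a b) _ (isUnit_single_pair_left hL a b)]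
    at h
  exact h

/-- A partition of unity with prescribed exponent: `Σ_a c_a g_a^n = 1`. [cite: StacksProject, Tag 00EK] -/
theorem exists_sum_mul_pow_eq_one [Fintype A] (hg : Ideal.span (Set.range g) = ⊤) (n : ℕ) :
    ∃ c : A → R, ∑ a, c a * g a ^ n = 1 := by
  have h := Ideal.span_pow_eq_top (Set.range g) hg n
  rw [← Set.range_comp, Ideal.eq_top_iff_one, Ideal.mem_span_range_iff_exists_fun] at h
  exact h

/-! ### Injectivity of `M → Č⁰` -/

/-- **`M → ∏_a M_{g_a}` is injective** when `(g_a) = R`: an element killed by a power of every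
`g_a` is zero. [cite: StacksProject, Tag 00EK] [cite: GortzWedhorn2023, Lemma 22.1] -/
theorem eq_zero_of_forall_ι_eq_zero [Finite A] (hg : Ideal.span (Set.range g) = ⊤)
    (hL : IsSystem g 1 L ι) {m : M} (h : ∀ k : Fin 1 → A, ι 0 k m = 0) : m = 0 := by
  classical
  haveI := Fintype.ofFinite A
  have h1 : ∀ a : A, ∃ e : ℕ, g a ^ e • m = 0 := fun a => by
    simpa only [gprod_single] using exists_pow_smul_eq_zero hL (single a) (h (single a))
  choose e he using h1
  obtain ⟨N, heN⟩ : ∃ N : ℕ, ∀ a, e a ≤ N :=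
    ⟨Finset.univ.sup e, fun a => Finset.le_sup (f := e) (Finset.mem_univ a)⟩
  have hN' : ∀ a, g a ^ N • m = 0 := fun a => by
    rw [← Nat.sub_add_cancel (heN a), pow_add, mul_smul, he, smul_zero]
  obtain ⟨c, hc⟩ := exists_sum_mul_pow_eq_one hg N
  calc m = (∑ a, c a * g a ^ N) • m := by rw [hc, one_smul]
    _ = ∑ a, c a • g a ^ N • m := by rw [Finset.sum_smul]; simp only [mul_smul]
    _ = 0 := Finset.sum_eq_zero fun a _ => by rw [hN', smul_zero]

/-! ### Gluing: `ker(Č⁰ → Č¹) = M` -/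

/-- **Gluing (`Ȟ⁰ = M`)**: when `(g_a) = R` and `A` is finite, every `0`-cochain `s = (s_a)` of a
localizing system with `D s = 0` — `s_a|_{ab} = s_b|_{ab}` for all `a, b` — is the image
`(ι_a r)_a` of one element `r ∈ M`. [cite: StacksProject, Tag 00EK] [cite: GortzWedhorn2023, Lemma 22.1]
[cite: Hartshorne1977, II Prop. 5.1] -/
theorem exists_eq_ι_of_cechD_eq_zero [Finite A] (hg : Ideal.span (Set.range g) = ⊤)
    (hL : IsSystem g 1 L ι) (s : Cochain L 0) (hs : cechD hL 0 s = 0) :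
    ∃ r : M, ∀ k : Fin 1 → A, ι 0 k r = s k := by
  classical
  haveI := Fintype.ofFinite A
  -- Step 1: numerators with a common exponent, `g_a^N s_a = ι_a (r_a)`
  have h1 : ∀ a : A, ∃ (e : ℕ) (m : M), g a ^ e • s (single a) = ι 0 (single a) m := fun a => by
    simpa only [gprod_single] using exists_pow_smul_eq_ι hL (single a) (s (single a))
  choose e m hm using h1
  obtain ⟨N, heN⟩ : ∃ N : ℕ, ∀ a, e a ≤ N :=
    ⟨Finset.univ.sup e, fun a => Finset.le_sup (f := e) (Finset.mem_univ a)⟩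
  obtain ⟨r, hr'⟩ : ∃ r : A → M, ∀ a, g a ^ N • s (single a) = ι 0 (single a) (r a) :=
    ⟨fun a => g a ^ (N - e a) • m a, fun a => by
      rw [map_smul, ← hm, smul_smul, ← pow_add, Nat.sub_add_cancel (heN a)]⟩
  -- Step 2: on overlaps `ι_{ab} (g_b^N r_a − g_a^N r_b) = 0`, hence killed by a power of `g_a g_b`
  have h2 : ∀ a b, ∃ d : ℕ, (g a * g b) ^ d • (g b ^ N • r a - g a ^ N • r b) = 0 := by
    intro a b
    have h0 : ι 1 (pair a b) (g b ^ N • r a - g a ^ N • r b) = 0 := by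
      rw [map_sub, map_smul, map_smul,
        ← transfer_ι hL (single a) (pair a b) (isUnit_single_pair_left hL a b) (r a),
        ← transfer_ι hL (single b) (pair a b) (isUnit_single_pair_right hL a b) (r b), ← hr', ← hr',
        map_smul, map_smul, smul_smul, smul_smul, mul_comm (g b ^ N),
        transfer_eq_transfer_of_cechD_eq_zero hL s hs a b, sub_self]
    simpa only [gprod_pair] using exists_pow_smul_eq_zero hL (pair a b) h0
  choose d hd using h2
  obtain ⟨E, hdE⟩ : ∃ E : ℕ, ∀ a b, d a b ≤ E :=
    ⟨Finset.univ.sup fun ab : A × A => d ab.1 ab.2, fun a b =>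
      Finset.le_sup (f := fun ab : A × A => d ab.1 ab.2) (Finset.mem_univ (a, b))⟩
  -- Step 3: absorb the exponents, `r'_a = g_a^E r_a`
  obtain ⟨r', hr'def⟩ : ∃ r' : A → M, ∀ a, r' a = g a ^ E • r a := ⟨_, fun a => rfl⟩
  have h3 : ∀ a b, g b ^ (N + E) • r' a = g a ^ (N + E) • r' b := by
    intro a b
    have h' : (g a * g b) ^ E • (g b ^ N • r a - g a ^ N • r b) = 0 := by
      rw [← Nat.sub_add_cancel (hdE a b), pow_add, mul_smul, hd, smul_zero]
    rw [smul_sub, sub_eq_zero, smul_smul, smul_smul] at h'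
    rw [hr'def, hr'def, smul_smul, smul_smul,
      show g b ^ (N + E) * g a ^ E = (g a * g b) ^ E * g b ^ N by ring,
      show g a ^ (N + E) * g b ^ E = (g a * g b) ^ E * g a ^ N by ring]
    exact h'
  have h4 : ∀ a, g a ^ (N + E) • s (single a) = ι 0 (single a) (r' a) := fun a => by
    rw [hr'def, map_smul, ← hr', smul_smul, ← pow_add, add_comm]
  -- Step 4: glue with a partition of unity `Σ_a c_a g_a^{N+E} = 1`
  obtain ⟨c, hc⟩ := exists_sum_mul_pow_eq_one hg (N + E)
  refine ⟨∑ a, c a • r' a, fun k => ?_⟩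
  rw [eq_single k]
  refine smul_pow_injective hL (single (k 0)) (N + E) ?_
  rw [gprod_single, h4, ← map_smul]
  congr 1
  rw [Finset.smul_sum]
  calc ∑ a, g (k 0) ^ (N + E) • c a • r' a = ∑ a, c a • g a ^ (N + E) • r' (k 0) :=
      Finset.sum_congr rfl fun a _ => by rw [smul_comm, h3 a (k 0)]
    _ = (∑ a, c a * g a ^ (N + E)) • r' (k 0) := by rw [Finset.sum_smul]; simp only [mul_smul]
    _ = r' (k 0) := by rw [hc, one_smul]

end CechLocalization

end Literature.Algebra.Homology
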